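import Mathlib
import HarnessLib
import HarnessLib.Audit
import Summits.AtomisticToContinuum.Statement

/-!
Route: ImplosionLoophole

CLOSED (retired) 2026-08-15T13:43:26Z by operator:999:1257524 — reason: not-a-thesis: assembly does not conclude the sub-problem Statement — note: D-0027 §2.1 audit (human 2026-08-15: routes that do not decide the summit are removed): the assembly concludes `Literature.MathematicalPhysics.KineticTheory.HydrodynamicLimit`, not the sub-problem statement; a NEW conforming route may be opened from the same idea (generated `closes : … → _root_.Hydr. The file is kept as the record of this route; refuted decls are indexed as negative knowledge (`ledger negatives`).

# Route ImplosionLoophole — Implosion loophole — the conjunct equals (packing-guarded conjunct) +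
(dilute self-consistency); decide the PDE dichotomy DiluteSelfConsistency vs DenseExcursion by
implosion tracking

Realises card implosion-loophole (keeper of implosion-beats-the-shock). In the typed conjunct σ₀
depends on the profiles only,
while T and the classical hard-sphere-Euler solution are quantified AFTER σ: nothing bounds the
local packing fraction ρ_t(x)σ³
along the solution, yet every route on the board (RelEntropyErgodic, VanishingNoise,
DenseKineticExpansion, DissipativeWeakStrong,
ChaoticMixing) uses cluster-expansion / low-density inputs at the LOCAL density. It suffices to show
X = X₁ ∧ X₂ with
X₁ = DiluteSelfConsistency (for all profiles and every η > 0 there is σ₀ such that for σ < σ₀ every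
admissible classical solution —
admissible = its t = 0 fields are the LLN limit of the local Gibbs state — has packing ρ_t(x)σ³ < η
on all of [0,T)) and
X₂ = HydroLimitInBand (the packing-guarded conjunct: same conclusion as HydrodynamicLimit under the
extra hypothesis
∀ t < T ∀ x, ρ_t(x)σ³ < η₀, with ∃ η₀ > 0 outermost; audit D5 variant). X₁ → X₂ → HydrodynamicLimit
is pure quantifier
bookkeeping (proved in the planner's Sketch.lean). This route OWNS X₁ and its negation
DenseExcursion (shock-free self-similar
IMPLOSION of the γ = 5/3 gas tracked by the σ-family until packing ≥ η); X₂ is the common residual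
of the five positive routes,
filed typed so they can re-target. Whichever horn closes is decisive: X₁ proved ⇒ the hidden PDE
crux of every route is discharged;
DenseExcursion proved ⇒ X₁ refuted, this route and (in substance) every σ₀-from-cluster-expansion
plan break, and the operator's
ruling on audit D5/Q2 must be revisited with a theorem in hand.
Lean: `(∀ η : ℝ, 0 < η → ∀ (a₀ θ₀ : Literature.MathematicalPhysics.KineticTheory.T3 → ℝ) (u₀ :
Literature.MathematicalPhysics.KineticTheory.T3 → Literature.MathematicalPhysics.KineticTheory.V3),
Continuous a₀ → Continuous θ₀ → Continuous u₀ → (∀ x, 0 < a₀ x) → (∀ x, 0 < θ₀ x) → ∃ σ₀ : ℝ, 0 < σ₀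
∧ ∀ σ : ℝ, 0 < σ → σ < σ₀ → ∀ (T : ℝ) (ρ θ : ℝ → Literature.MathematicalPhysics.KineticTheory.T3 →
ℝ) (u : ℝ → Literature.MathematicalPhysics.KineticTheory.T3 →
Literature.MathematicalPhysics.KineticTheory.V3),
Literature.MathematicalPhysics.KineticTheory.IsHardSphereEulerSolution σ T ρ u θ → ∀ Φ : (N : ℕ) →
Literature.Analysis.FluidPDE.HardSphereFlow (Literature.Analysis.FluidPDE.Torus.geometry (Fin 3))
(Literature.MathematicalPhysics.KineticTheory.hsDiameter σ N) (N + 1),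
Literature.MathematicalPhysics.KineticTheory.TendstoHydroFieldsAt (fun N =>
Literature.MathematicalPhysics.KineticTheory.localGibbsLaw σ a₀ u₀ θ₀ N (Φ N)) Φ ρ u θ 0 → ∀ t ∈
Set.Ico 0 T, ∀ x, ρ t x * σ ^ 3 < η) ∧ (∃ η₀ : ℝ, 0 < η₀ ∧ ∀ (a₀ θ₀ :
Literature.MathematicalPhysics.KineticTheory.T3 → ℝ) (u₀ :
Literature.MathematicalPhysics.KineticTheory.T3 → Literature.MathematicalPhysics.KineticTheory.V3),
Continuous a₀ → Continuous θ₀ → Continuous u₀ → (∀ x, 0 < a₀ x) → (∀ x, 0 < θ₀ x) → ∃ σ₀ : ℝ, 0 < σ₀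
∧ ∀ σ : ℝ, 0 < σ → σ < σ₀ → ∀ (T : ℝ) (ρ θ : ℝ → Literature.MathematicalPhysics.KineticTheory.T3 →
ℝ) (u : ℝ → Literature.MathematicalPhysics.KineticTheory.T3 →
Literature.MathematicalPhysics.KineticTheory.V3),
Literature.MathematicalPhysics.KineticTheory.IsHardSphereEulerSolution σ T ρ u θ → (∀ t ∈ Set.Ico 0
T, ∀ x, ρ t x * σ ^ 3 < η₀) → ∀ Φ : (N : ℕ) → Literature.Analysis.FluidPDE.HardSphereFlow
(Literature.Analysis.FluidPDE.Torus.geometry (Fin 3))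
(Literature.MathematicalPhysics.KineticTheory.hsDiameter σ N) (N + 1),
Literature.MathematicalPhysics.KineticTheory.TendstoHydroFieldsAt (fun N =>
Literature.MathematicalPhysics.KineticTheory.localGibbsLaw σ a₀ u₀ θ₀ N (Φ N)) Φ ρ u θ 0 → ∀ t ∈
Set.Ico 0 T, Literature.MathematicalPhysics.KineticTheory.TendstoHydroFieldsAt (fun N =>
Literature.MathematicalPhysics.KineticTheory.localGibbsLaw σ a₀ u₀ θ₀ N (Φ N)) Φ ρ u θ t)`

## Assembly
Pure logic: from HydroLimitInBand take η₀; from DiluteSelfConsistency at η := η₀ and the given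
profiles take σ₁, from
HydroLimitInBand take σ₂; with σ₀ := min σ₁ σ₂, for σ < σ₀ and any admissible classical solution and
flow family the packing
guard holds on all of [0,T) by DiluteSelfConsistency, so HydroLimitInBand gives the LLN at every t <
T, which is HydrodynamicLimit
(unfolded, hydrodynamicLimit_iff). Proved verbatim as `assembly_holds` in the planner's Sketch.lean
(rc 0).

Rationale: WHY THIS LINE. The "first shock" clause of the conjunct was written for gradient catastrophes, where
the density stays bounded up to T*; the
other first singularity of 3-D compressible Euler, smooth self-similar IMPLOSION (MerleEtAl2022; all
γ > 1 incl. the monatomic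
γ = 5/3 of the σ → 0 hard-sphere gas: BuckmasterCaolaboraGomezserrano2025, ShaoEtAl2025; C^∞
periodic data on 𝕋³ with
finite-codimension stability: CaolaboraEtAl2025 Thm 1.2, Rem 1.4–1.5), keeps the solution classical
while ρ → ∞, so for
implosion profiles the admissible σ-solutions reach arbitrarily large density before their own first
singularity (continuous
dependence in the equation-of-state parameter σ³; support EosContinuity + IdealGasImplosion ⇒
ImplosionUnboundedDensity) and
the only question is the RATE: packing = σ³·ρ reaches O(1) iff the σ-family shadows the collapse for
a self-similar time
≳ (3/β)·log(1/σ), a race between the density growth exponent β = (1−1/r)/α = 3(1−1/r) ∈ (0, 0.63) (γ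
= 5/3, r < r* = 1.268,
CaolaboraEtAl2025 p. 42) and the top genuine unstable eigenvalue of the linearised self-similar
operator, continuously fed by
the O(ρσ³) equation-of-state defect and the O(σ³) non-isentropy of the local-Gibbs data. Imported
area: singularity formation
for compressible Euler (modulation/self-similar stability: MerleEtAl2022, CaolaboraEtAl2025,
ChenShkollerVicol2026) plus
classical continuous dependence for symmetric hyperbolic systems (Kato1975, Majda1984); the statics
input is the low-density
cluster expansion (Ruelle1969 §3.4, LebowitzPenrose1964). A twist found while scoping: the 2026
STABLE smooth implosions of
ChenShkollerVicol2026 (full non-isentropic Euler, explicit exponents, ground state stable modulo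
p(0) = 0) are EXCLUDED by the
conjunct's strict positivity θ₀ > 0, θ > 0 (their pressure vanishes at the centre, i.e. θ = 0 there;
the authors note the
local Maxwellian degenerates to a Dirac mass, arXiv:2605.00808 §1.6), while the admissible
isentropic implosions are
conjectured radially unstable (Biasi2021) — so the conjunct's positivity clauses may be exactly what
closes the loophole, and
the dichotomy is a sharp, paper-decidable PDE question either way. No prior route or negative
touches the quantifier order or
the local density along the Euler solution; DenseKineticExpansion's why-might-fail of
EnskogHydrodynamics records the Z = 1 junk
for η > 6/π as a typing issue only.

RANKED CRUXES. #2 DenseExcursion (crux) — (card crux 1A, implosion tracking wins) there are η > 0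
and continuous positive profiles (a₀, u₀, θ₀) such that for every σ₀ > 0 some σ ∈ (0, σ₀) admits a
classical hard-sphere-Euler solution on some [0,T) whose t = 0 fields are the LLN limit of the local
Gibbs laws (for every flow family) and whose packing reaches η: ∃ t < T, x with η ≤ ρ_t(x)σ³.
Intended construction: smooth isentropic γ = 5/3 implosion data on 𝕋³ (CaolaboraEtAl2025 Thm 1.2 /
Rem 1.5) as (a₀/∫a₀, u₀, θ₀ = K(a₀/∫a₀)^{2/3}); forced finite-codimension stability in self-similar
variables for the barotropic-along-the-isentrope law p_σ(ρ) = ρθ(ρ)Z(ρσ³) up to packing η below the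
analyticity radius of Z. Together with Alexander's theorem (HardSphereFlow.nonempty_torus) it
refutes DiluteSelfConsistency (Sketch: denseExcursion_not_dilute). [deps: IdealGasImplosion,
EosContinuity, LocalGibbsDensityLimit] [difficulty: XL] (why it might fail: If the top genuine
unstable rate λ of the admissible (isentropic, ρ,p>0) implosion exceeds β=3(1−1/r), generic O(σ³)
defects eject the σ-solution at packing σ^{3(1−β/λ)}→0 (Biasi2021 numerics: radial instability); the
stable CSV implosions need θ(0)=0, excluded by θ₀>0.) [CaolaboraEtAl2025,
BuckmasterCaolaboraGomezserrano2025, ShaoEtAl2025, MerleEtAl2022, ChenShkollerVicol2026, Biasi2021,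
Alexander1975]
#3 DiluteSelfConsistency (crux) — (card crux 1B ∪ 3; the hidden PDE crux of every route) for every η
> 0 and all continuous positive profiles there is σ₀ > 0 such that for 0 < σ < σ₀, every classical
hard-sphere-Euler solution on [0,T) whose t = 0 fields are the LLN limit of the local Gibbs laws
satisfies ρ_t(x)σ³ < η for all t < T and x — i.e. limsup_{σ→0} σ³ sup_{t<T*_σ} ‖ρ_σ(t)‖_∞ = 0
profile by profile. For profiles whose ideal-gas development is global or breaks by a non-degenerate
shock (Luk–Speck / Buckmaster–Shkoller–Vicol open sets) this is stability of shock formation under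
an O(σ³) equation-of-state and data perturbation; in general it is a σ-uniform density bound at the
FIRST singularity of 3-D compressible Euler for all smooth data. [deps: EosContinuity,
LocalGibbsDensityLimit] [difficulty: open-problem] (why it might fail: DenseExcursion (implosion
tracking) refutes it outright; and even if true it asks for σ-uniform density control at the first
singularity for ALL smooth profiles — beyond Sideris1985/LukSpeck2024-type theory, which covers open
sets of data only (generic-singularity problem).) [Sideris1985, LukSpeck2024, CaolaboraEtAl2025,
ChenShkollerVicol2026, Kato1975, Spohn1991]
#4 PolynomialCompression (crux) — (quantitative rung between ImplosionUnboundedDensity and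
DenseExcursion) there are κ > 0 and continuous positive profiles such that for every σ₀ > 0 some σ ∈
(0, σ₀) admits an admissible classical hard-sphere-Euler solution (t = 0 fields = LLN limit of the
local Gibbs laws for every flow family) reaching density σ^{−κ}: ∃ t < T, x with σ^{−κ} ≤ ρ_t(x)
(packing σ^{3−κ}). Route: Gronwall-type continuous dependence in self-similar variables around the γ
= 5/3 implosion with the natural (T*−t)^{−C} loss, so the σ-solution shadows the collapse until T*−t
≍ σ^{3/C}; κ = 3β/C. DenseExcursion is the case κ = 3 with a constant. [deps: IdealGasImplosion,
EosContinuity, LocalGibbsDensityLimit] [difficulty: L] (why it might fail: Needs energy estimates in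
self-similar variables with an exponential-in-s loss for the FORCED problem (EOS defect O(ρσ³), data
non-isentropy O(σ³)) and the typed Z smooth on [0,η] (HsEosLowDensity, unproved); the local-Gibbs
density must be σ³-close to a₀/∫a₀ in C^k, not in print.) [CaolaboraEtAl2025, MerleEtAl2022,
Kato1975, Majda1984, Ruelle1969, LebowitzPenrose1964]
#9 HydroLimitInBand (support) — [support, NOT staffed by this route] the packing-guarded conjunct: ∃
η₀ > 0 such that for all continuous positive profiles ∃ σ₀ ∀ σ ∈ (0,σ₀) ∀ classical
hard-sphere-Euler solutions on [0,T) WITH ρ_t(x)σ³ < η₀ on [0,T) × 𝕋³ and all flow families, LLN of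
the fields at t = 0 ⇒ LLN at every t < T. This is what the five positive routes deliver in substance
(their inputs LocalGibbsConcentration 0767 / HsEosLowDensity 0768 live at local packing < η₀); the
audit's D5 variant HydrodynamicLimitInBand (∀ σ < 1/2 form) implies it. Filed typed so tenure
planners can re-target RelEntropyVanishing / L2HydroFields to guarded versions. [difficulty:
open-problem] [Spohn1991, OllaVaradhanYau1993,
docs/m5/audits/audit-AtomisticToContinuum-HydrodynamicLimit.md D5]
#9 IdealGasImplosion (support) — [support, literature input at σ = 0] there are continuous positive
profiles (a₀, u₀, θ₀) on 𝕋³ and a classical solution of the σ = 0 system (hsPressure 0 ρ θ = ρθ, E =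
ρ(|u|²/2 + 3θ/2): the monatomic ideal gas, γ = 5/3) on some [0,T₁), T₁ > 0, with data (a₀/∫a₀, u₀,
θ₀), whose density is unbounded on [0,T₁). Source theorem: CaolaboraEtAl2025 Thm 1.2 (𝕋³_L, C^∞
data, ρ₀ > 0, finite-codimension set) + Rem 1.4 (any torus size by scaling) + Rem 1.5 (Euler, ν = 0)
with γ = 5/3 profiles from BuckmasterCaolaboraGomezserrano2025 (p. 6: "for all γ > 1, including γ =
5/3") or ShaoEtAl2025; isentropic smooth data θ₀ = K ρ₀^{2/3} reduce the full system to the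
barotropic one while classical (entropy transport); mass normalisation ∫ρ₀ = 1 is free by the
two-parameter scaling of the ideal-gas system. [difficulty: XL] [CaolaboraEtAl2025,
BuckmasterCaolaboraGomezserrano2025, ShaoEtAl2025, MerleEtAl2022]
#9 EosContinuity (support) — [support] continuous dependence on the equation-of-state parameter with
existence: given profiles and a classical σ = 0 solution (ρ₁,u₁,θ₁) on [0,T₁) with data (a₀/∫a₀, u₀,
θ₀), for every 0 < T₂ < T₁ and ε > 0 there is σ₀ such that for 0 < σ < σ₀ (i) an admissible
classical hard-sphere-Euler solution exists on some [0,T) with T > T₂ (local well-posedness of the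
symmetric-hyperbolic hs-Euler system with Z analytic near 0, Kato1975/Majda1984, + the LLN for the
local Gibbs data), and (ii) every admissible classical solution is ε-close to ρ₁ in sup norm on [0,
min(T,T₂)] (uniqueness + Gronwall; data ρ_eq^σ → a₀/∫a₀ by LocalGibbsDensityLimit, hsPressure σ →
ideal uniformly on bounded densities by HsEosLowDensity 0768). [difficulty: L] [Kato1975, Majda1984,
Ruelle1969, LebowitzPenrose1964, Spohn1991]
#9 ImplosionUnboundedDensity (support) — [support, provable from IdealGasImplosion + EosContinuity]
there are continuous positive profiles such that for every M there is σ₀ with: for all 0 < σ < σ₀ an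
admissible classical hard-sphere-Euler solution exists whose density exceeds M somewhere on its
interval of existence. Records that no σ-uniform L^∞ density bound holds along the conjunct's
solution class (the qualitative implosion loophole); DenseExcursion / PolynomialCompression quantify
it. [difficulty: L] [CaolaboraEtAl2025, Kato1975, Majda1984]
#9 LocalGibbsDensityLimit (support) — [support, statics] for continuous positive profiles and ε > 0
there is σ₀ such that for 0 < σ < σ₀ the canonical local Gibbs laws of N+1 hard spheres of diameter
σ(N+1)^{-1/3} are probability measures for every N and every flow, and their empirical density /
momentum / energy fields at t = 0 satisfy the LLN (TendstoHydroFieldsAt at time 0) towards (ρ₀,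
ρ₀u₀, ρ₀(|u₀|²/2 + 3θ₀/2)) for a continuous ρ₀ with |ρ₀ − a₀/∫a₀| < ε uniformly (ideal-gas limit of
the equilibrium density at activity a₀; the O(σ³) rate for smooth a₀, needed by DenseExcursion /
PolynomialCompression, rides as a lemma). Strengthens the Literature fact localGibbs_lln and the
shared support LocalGibbsConcentration (stmt 0767) by identifying the limit density. [difficulty: M]
[Ruelle1969, LebowitzPenrose1964, Spohn1991]

TWO-LAYER PLAN. Foreseen glued splits (nothing filed now). DenseExcursion ⇐
ForcedSelfSimilarStability (the σ-solution stays in an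
O(packing + σ³e^{λs})-neighbourhood of the modulated CLGSS profile in self-similar variables while
packing ≤ η) →
ExitAfterPacking (β ≥ λ for the chosen profile: the neighbourhood is left only after packing η is
reached) → DenseExcursion.
DiluteSelfConsistency ⇐ ShockStableDilute (profiles whose ideal development ends in a non-degenerate
shock or is global:
σ-uniform density bound up to T*_σ, LukSpeck2024 / Buckmaster–Shkoller–Vicol stability transplanted
to the EOS family) →
NoOtherFirstSingularity (every other profile: classification — the genuinely open part) →
DiluteSelfConsistency.
PolynomialCompression ⇐ IdealGasImplosion → QuantitativeEosContinuity (error ≤ Cσ³(T*−t)^{−C}) →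
PolynomialCompression.

KILL CRITERIA. DenseExcursion proved (with Alexander1975's flow existence, named fact
HardSphereFlow.nonempty_torus) ⇒ DiluteSelfConsistency is
REFUTED ⇒ this route closes refuted:DiluteSelfConsistency BY DESIGN, its census being the theorem
that the typed conjunct forces
dense-fluid control (packing ≥ η for admissible profiles at every small σ) on every route; the
planner then asks the operator to
re-open audit D5/Q2 (adopt HydroLimitInBand, or quantify T before σ₀) — the positive routes
re-target to the guarded statements.
DiluteSelfConsistency proved ⇒ DenseExcursion and PolynomialCompression-with-κ≥3 are refuted (moot),
the route has delivered the
hidden crux and stays open only as the holder of HydroLimitInBand (superseded by whichever positive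
route proves it).
A proof that the CLGSS γ = 5/3 profiles have top unstable rate λ > β AND that no admissible (ρ, θ >
0) implosion is stable closes the
implosion door: then DenseExcursion is demoted to support and the route pivots to
"DiluteSelfConsistency for open sets of profiles".
Operator adoption of the guarded conjunct moots the whole route (intended cheap outcome).

NOT DECOMPOSED YET. The forced self-similar stability statement (needs the linearised CLGSS operator
on 𝕋³ as a Lean object — no definition
requested until a PDE grounder confirms the β-vs-λ numbers); the O(σ³) C^k expansion of the
canonical local-Gibbs density for
smooth activity (a lemma under LocalGibbsDensityLimit, attached with --supports when a prover needs
it); restriction/uniqueness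
lemmas for IsHardSphereEulerSolution (solution on [0,T) restricts to [0,T'), classical uniqueness);
the negative assembly
DenseExcursion ∧ FreezingReached ∧ NonFluidResponse → ¬HydrodynamicLimit of the card (crux
"particles do not follow the formal
EOS beyond freezing" is not credible today: no rigorous hard-sphere freezing) — deliberately NOT
filed; smooth-vs-continuous
profiles (audit D6) — all statements keep `Continuous` and let classical existence force smoothness.

CHEAPEST FALSIFIER. For DenseExcursion: read off (or recompute, Biasi2021-style collocation; kit job
not run — compute quota not requested in
plancard mode) the top radial/non-radial unstable growth rate λ of the linearised self-similar
operator at the γ = 5/3 CLGSS/BCLG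
profile and compare with β = 3(1−1/r): λ > β for every admissible profile kills the intended
construction (packing at exit
σ^{3(1−β/λ)} → 0). For DiluteSelfConsistency: any admissible (ρ, θ > 0 everywhere) smooth implosion
that is STABLE (open set of
data) kills it at once via EosContinuity-type shadowing — none is known: ChenShkollerVicol2026's
stable ground state needs p = 0
at the centre (θ = 0, inadmissible), MRRS-type ones are finite-codimension only. For the whole line:
the operator adopting the
guarded conjunct (audit D5 variant) makes it moot — by far the cheapest.

NUMBERS. γ = 5/3 ⇒ α = (γ−1)/2 = 1/3; CLGSS self-similar range 1 < r < r*(5/3) = (3γ−1)/(2+√3(γ−1))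
= 1.268 (CaolaboraEtAl2025 p. 42,
(r*_{≥5/3})); core density ρ(0,t) ≍ (T*−t)^{−(1−1/r)/α} = (T*−t)^{−3(1−1/r)}, exponent ∈ (0, 0.634).
Tracking to packing η from
data packing ≍ σ³ needs density amplification σ^{−3}, i.e. shadowing down to T*−t ≍ σ^{1/(1−1/r)} ≤
σ^{4.7}. Hard-sphere
landmarks (physics, not used in any statement): freezing ρσ³ ≈ 0.94, random close packing ≈ 1.22,
close packing √2 (beyond which
the typed Z = 1 by Real.log 0 = 0). ChenShkollerVicol2026 monatomic 3-D ground state: dim Σ_uns = 11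
of 98 Taylor modes ≤ 2,
explicit exponents c_x*(3,5/3,1) = 1/2 + (1/2)√(47/12) ≈ 1.4895 — inadmissible here (p(0) = 0).

DEFINITION REQUESTS. None now. Later (layer 2): the linearised self-similar Euler operator around a
profile on 𝕋³ (for ForcedSelfSimilarStability);
possibly `IsHardSphereEulerSolution.restrict` API lemmas (Theorems-side, no definition).

Novelty: Searches (2026-08-15): lit search --hybrid "smooth imploding solutions compressible Euler
self-similar torus" (8 held books, none on
implosion; CLGSS held as paper:arxiv-2310.05325, read pp. 5–7, 41–43); lit search --hybrid
"implosion density blow-up hydrodynamic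
limit particle system local equilibrium packing fraction" (KipnisLandim1999, DeMasi–Presutti,
Saint-Raymond 2009 — no implosion);
lit search --source zbmath "implosion compressible Euler" 2021+ (17 hits: MerleEtAl2022 I–II,
CaolaboraEtAl2025,
BuckmasterCaolaboraGomezserrano2025, Biasi2021, arXiv:2605.00808 ChenShkollerVicol2026 read §1 pp.
2–15, arXiv:2606.18152,
arXiv:2606.29454, arXiv:2511.03033, arXiv:2602.05981); crossref "imploding non-isentropic" (noise);
openalex/s2/arxiv rate-limited
(429), lit galaxy --star all saturated (logged). Nearest prior art found: (i) ChenShkollerVicol2026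
§1.6 with Bedrossian–Chen–
Gualdani et al. arXiv:2602.05981 — implosion versus the self-consistency of a DERIVED description,
but on the Knudsen side
(dilute Landau/Boltzmann: collision rate must outrun the collapse, condition −3c_b + (γ_kin+3)c_u +
1 < 0; implosion helps);
(ii) OllaVaradhanYau1993 §1 p. 525 "may enter the region of phase coexistence"; (iii) internal audit
D5/Q2 (quantifier placement,
ruled non-blocking without a mechanism). Delta: point the admissible (ρ, θ > 0) periodic γ = 5/3
implosions at the PACKING side of
the fixed-reduced-density N-body conjunct, where implosion hurts, extract the typed dichotomy
DiluteSel  [refs: 2605.00808, 2606.18152, 2606.29454, 2511.03033, 2602.05981, paper:arxiv-2310.05325, KipnisLandim1999, MerleEtAl2022, CaolaboraEtAl2025, BuckmasterCaolaboraGomezserrano2025, Biasi2021, ChenShkollerVicol2026, OllaVaradhanYau1993]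

Barriers (technique_class: implosion-tracking, statement-audit, negative-side): - technique_class: implosion-tracking, statement-audit, negative-side
- Literature.Barriers.AtomisticToContinuum.ShockFormationBarrier: orthogonal — its kernel
(Sideris1985 Thm 1, polytropic gas on ℝ³) is gradient blow-up with bounded density and it restricts
post-shock strengthenings only; every statement here lives strictly before the first singularity of
a classical solution, and exploits the singularity type (implosion: density blow-up while C^∞) the
barrier's scope caveat (a) leaves uncovered for the hard-sphere EOS on 𝕋³.
- Literature.Barriers.AtomisticToContinuum.DiluteRegimeBarrier: consonant, used inverted — the
barrier says kinetic derivations reach only dilute scalings; this line shows the typed conjunct's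
SOLUTION CLASS is not confined to small local packing for any profile-dependent σ₀ unless
DiluteSelfConsistency holds, so every method must prove it or work at packing O(1).
- Literature.Barriers.AtomisticToContinuum.NoDensityExpansionBarrier: not met by any filed statement
(no density/virial expansion of transport coefficients is used); it is one more reason the card's
dense-regime negative assembly (beyond freezing) is NOT filed.
- Literature.Barriers.AtomisticToContinuum.WildSolutionsBarrier: not met — no weak or
post-singularity solutions; all items quantify classical solutions on [0,T).
- Literature.Barriers.AtomisticToContinuum.VelocityReversalBarrier: not met — no sure-convergence
claim; the only particle-side content is the LLN at t = 0 (in probability) a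

History (route lifecycle, newest last):
- 2026-08-15T13:43:26Z · CLOSED retired — not-a-thesis: assembly does not conclude the sub-problem Statement (operator:999:1257524)

sub-problem: HydrodynamicLimit · status: closed(retired) · opened planner-plancard-AtomisticToContinuum-Hydrody-abe17de6-0 2026-08-15T11:11:16Z · rev 0 · ledger route-AtomisticToContinuum-ImplosionLoophole
GENERATED by the gate from the ledger (D-0016/17). Provers cite these decls: `theorem foo : Summit.AtomisticToContinuum.HydrodynamicLimit.Theses.ImplosionLoophole.<Decl> := …` in Summits/AtomisticToContinuum/HydrodynamicLimit/Theorems/<Name>.lean.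
-/

namespace Summit.AtomisticToContinuum.HydrodynamicLimit.Theses.ImplosionLoophole

open scoped BigOperators Topology Manifold Classical MeasureTheory ProbabilityTheory Matrix InnerProductSpace ComplexConjugate ContinuousMap
open Filter Set Function TopologicalSpace MeasureTheory

attribute [summit_statement] _root_.HydrodynamicLimit

/-- item stmt-AtomisticToContinuum-3090 · crux · rank 2 · closed · moot by None · by planner
why it might fail: If the top genuine unstable rate λ of the admissible (isentropic, ρ,p>0) implosion exceeds β=3(1−1/r), generic O(σ³) defects eject the σ-solution at packing σ^{3(1−β/λ)}→0 (Biasi2021 numerics: radial instability); the stable CSV implosions need θ(0)=0, excluded by θ₀>0.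
sources: CaolaboraEtAl2025, BuckmasterCaolaboraGomezserrano2025, ShaoEtAl2025, MerleEtAl2022, ChenShkollerVicol2026, Biasi2021
[crux] (card crux 1A, implosion tracking wins) there are η > 0 and continuous positive profiles (a₀,
u₀, θ₀) such that for every σ₀ > 0 some σ ∈ (0, σ₀) admits a classical hard-sphere-Euler solution on
some [0,T) whose t = 0 fields are the LLN limit of the local Gibbs laws (for every flow family) and
whose packing reaches η: ∃ t < T, x with η ≤ ρ_t(x)σ³. Intended construction: smooth isentropic γ =
5/3 implosion data on 𝕋³ (CaolaboraEtAl2025 Thm 1.2 / Rem 1.5) as (a₀/∫a₀, u₀, θ₀ =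
K(a₀/∫a₀)^{2/3}); forced finite-codimension stability in self-similar variables for the
barotropic-along-the-isentrope law p_σ(ρ) = ρθ(ρ)Z(ρσ³) up to packing η below the analyticity radius
of Z. Together with Alexander's theorem (HardSphereFlow.nonempty_torus) it refutes
DiluteSelfConsistency (Sketch: denseExcursion_not_dilute). [deps: IdealGasImplosion, EosContinuity,
LocalGibbsDensityLimit] [difficulty: XL] -/
@[route_item "route-AtomisticToContinuum-ImplosionLoophole"]
def DenseExcursion : Prop :=
  ∃ η : ℝ, 0 < η ∧ ∃ (a₀ θ₀ : Literature.MathematicalPhysics.KineticTheory.T3 → ℝ) (u₀ : Literature.MathematicalPhysics.KineticTheory.T3 → Literature.MathematicalPhysics.KineticTheory.V3), Continuous a₀ ∧ Continuous θ₀ ∧ Continuous u₀ ∧ (∀ x, 0 < a₀ x) ∧ (∀ x, 0 < θ₀ x) ∧ ∀ σ₀ : ℝ, 0 < σ₀ → ∃ σ : ℝ, 0 < σ ∧ σ < σ₀ ∧ ∃ (T : ℝ) (ρ θ : ℝ → Literature.MathematicalPhysics.KineticTheory.T3 → ℝ) (u : ℝ → Literature.MathematicalPhysics.KineticTheory.T3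 → Literature.MathematicalPhysics.KineticTheory.V3), Literature.MathematicalPhysics.KineticTheory.IsHardSphereEulerSolution σ T ρ u θ ∧ (∀ Φ : (N : ℕ) → Literature.Analysis.FluidPDE.HardSphereFlow (Literature.Analysis.FluidPDE.Torus.geometry (Fin 3)) (Literature.MathematicalPhysics.KineticTheory.hsDiameter σ N) (N + 1), Literature.MathematicalPhysics.KineticTheory.TendstoHydroFieldsAt (fun N => Literature.MathematicalPhysics.KineticTheory.localGibbsLaw σ a₀ u₀ θ₀ N (Φ N)) Φ ρ u θ 0) ∧ ∃ t ∈ Set.Ico 0 T, ∃ x, η ≤ ρ t x * σ ^ 3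

/-- item stmt-AtomisticToContinuum-3091 · crux · rank 3 · open · by planner
why it might fail: DenseExcursion (implosion tracking) refutes it outright; and even if true it asks for σ-uniform density control at the first singularity for ALL smooth profiles — beyond Sideris1985/LukSpeck2024-type theory, which covers open sets of data only (generic-singularity problem).
sources: Sideris1985, LukSpeck2024, CaolaboraEtAl2025, ChenShkollerVicol2026, Kato1975, Spohn1991
[crux] (card crux 1B ∪ 3; the hidden PDE crux of every route) for every η > 0 and all continuous
positive profiles there is σ₀ > 0 such that for 0 < σ < σ₀, every classical hard-sphere-Euler
solution on [0,T) whose t = 0 fields are the LLN limit of the local Gibbs laws satisfies ρ_t(x)σ³ <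
η for all t < T and x — i.e. limsup_{σ→0} σ³ sup_{t<T*_σ} ‖ρ_σ(t)‖_∞ = 0 profile by profile. For
profiles whose ideal-gas development is global or breaks by a non-degenerate shock (Luk–Speck /
Buckmaster–Shkoller–Vicol open sets) this is stability of shock formation under an O(σ³)
equation-of-state and data perturbation; in general it is a σ-uniform density bound at the FIRST
singularity of 3-D compressible Euler for all smooth data. [deps: EosContinuity,
LocalGibbsDensityLimit] [difficulty: open-problem] -/
@[route_item "route-AtomisticToContinuum-ImplosionLoophole"]
def DiluteSelfConsistency : Prop :=
  ∀ η : ℝ, 0 < η → ∀ (a₀ θ₀ : Literature.MathematicalPhysics.KineticTheory.T3 → ℝ) (u₀ : Literature.MathematicalPhysics.KineticTheory.T3 → Literature.MathematicalPhysics.KineticTheory.V3), Continuous a₀ → Continuous θ₀ → Continuous u₀ → (∀ x, 0 < a₀ x) → (∀ x, 0 < θ₀ x) → ∃ σ₀ : ℝ, 0 < σ₀ ∧ ∀ σ : ℝ, 0 < σ → σ < σ₀ → ∀ (T : ℝ) (ρ θ : ℝ → Literature.MathematicalPhysics.KineticTheory.T3 → ℝ) (u : ℝ → Literature.MathematicalPhysics.KineticTheory.T3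 → Literature.MathematicalPhysics.KineticTheory.V3), Literature.MathematicalPhysics.KineticTheory.IsHardSphereEulerSolution σ T ρ u θ → ∀ Φ : (N : ℕ) → Literature.Analysis.FluidPDE.HardSphereFlow (Literature.Analysis.FluidPDE.Torus.geometry (Fin 3)) (Literature.MathematicalPhysics.KineticTheory.hsDiameter σ N) (N + 1), Literature.MathematicalPhysics.KineticTheory.TendstoHydroFieldsAt (fun N => Literature.MathematicalPhysics.KineticTheory.localGibbsLaw σ a₀ u₀ θ₀ N (Φ N)) Φ ρ u θ 0 → ∀ t ∈ Set.Ico 0 T, ∀ x, ρ t x * σ ^ 3 < η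

/-- item stmt-AtomisticToContinuum-3092 · crux · rank 4 · closed · moot by None · by planner
why it might fail: Needs energy estimates in self-similar variables with an exponential-in-s loss for the FORCED problem (EOS defect O(ρσ³), data non-isentropy O(σ³)) and the typed Z smooth on [0,η] (HsEosLowDensity, unproved); the local-Gibbs density must be σ³-close to a₀/∫a₀ in C^k, not in print.
sources: CaolaboraEtAl2025, MerleEtAl2022, Kato1975, Majda1984, Ruelle1969, LebowitzPenrose1964
[crux] (quantitative rung between ImplosionUnboundedDensity and DenseExcursion) there are κ > 0 and
continuous positive profiles such that for every σ₀ > 0 some σ ∈ (0, σ₀) admits an admissible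
classical hard-sphere-Euler solution (t = 0 fields = LLN limit of the local Gibbs laws for every
flow family) reaching density σ^{−κ}: ∃ t < T, x with σ^{−κ} ≤ ρ_t(x) (packing σ^{3−κ}). Route:
Gronwall-type continuous dependence in self-similar variables around the γ = 5/3 implosion with the
natural (T*−t)^{−C} loss, so the σ-solution shadows the collapse until T*−t ≍ σ^{3/C}; κ = 3β/C.
DenseExcursion is the case κ = 3 with a constant. [deps: IdealGasImplosion, EosContinuity,
LocalGibbsDensityLimit] [difficulty: L] -/
@[route_item "route-AtomisticToContinuum-ImplosionLoophole"]
def PolynomialCompression : Prop :=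
  ∃ κ : ℝ, 0 < κ ∧ ∃ (a₀ θ₀ : Literature.MathematicalPhysics.KineticTheory.T3 → ℝ) (u₀ : Literature.MathematicalPhysics.KineticTheory.T3 → Literature.MathematicalPhysics.KineticTheory.V3), Continuous a₀ ∧ Continuous θ₀ ∧ Continuous u₀ ∧ (∀ x, 0 < a₀ x) ∧ (∀ x, 0 < θ₀ x) ∧ ∀ σ₀ : ℝ, 0 < σ₀ → ∃ σ : ℝ, 0 < σ ∧ σ < σ₀ ∧ ∃ (T : ℝ) (ρ θ : ℝ → Literature.MathematicalPhysics.KineticTheory.T3 → ℝ) (u : ℝ → Literature.MathematicalPhysics.KineticTheory.T3 → Literature.MathematicalPhysics.KineticTheory.V3), Literature.MathematicalPhysics.KineticTheory.IsHardSphereEulerSolution σ T ρ u θ ∧ (∀ Φ : (N : ℕ) → Literature.Analysis.FluidPDE.HardSphereFlow (Literature.Analysis.FluidPDE.Torus.geometry (Fin 3)) (Literature.MathematicalPhysics.KineticTheory.hsDiameter σ N) (N + 1), Literature.MathematicalPhysics.KineticTheory.TendstoHydroFieldsAt (fun N => Literature.MathematicalPhysics.KineticTheory.localGibbsLaw σ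 a₀ u₀ θ₀ N (Φ N)) Φ ρ u θ 0) ∧ ∃ t ∈ Set.Ico 0 T, ∃ x, σ ^ (-κ) ≤ ρ t x

/-- item stmt-AtomisticToContinuum-3093 · support · rank 9 · closed · moot by None · by planner
sources: Spohn1991, OllaVaradhanYau1993, docs/m5/audits/audit-AtomisticToContinuum-HydrodynamicLimit.md D5
[support] [support, NOT staffed by this route] the packing-guarded conjunct: ∃ η₀ > 0 such that for
all continuous positive profiles ∃ σ₀ ∀ σ ∈ (0,σ₀) ∀ classical hard-sphere-Euler solutions on [0,T)
WITH ρ_t(x)σ³ < η₀ on [0,T) × 𝕋³ and all flow families, LLN of the fields at t = 0 ⇒ LLN at every t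
< T. This is what the five positive routes deliver in substance (their inputs
LocalGibbsConcentration 0767 / HsEosLowDensity 0768 live at local packing < η₀); the audit's D5
variant HydrodynamicLimitInBand (∀ σ < 1/2 form) implies it. Filed typed so tenure planners can
re-target RelEntropyVanishing / L2HydroFields to guarded versions. [difficulty: open-problem] -/
@[route_item "route-AtomisticToContinuum-ImplosionLoophole"]
def HydroLimitInBand : Prop :=
  ∃ η₀ : ℝ, 0 < η₀ ∧ ∀ (a₀ θ₀ : Literature.MathematicalPhysics.KineticTheory.T3 → ℝ) (u₀ : Literature.MathematicalPhysics.KineticTheory.T3 → Literature.MathematicalPhysics.KineticTheory.V3), Continuous a₀ → Continuous θ₀ → Continuous u₀ → (∀ x, 0 < a₀ x) → (∀ x, 0 < θ₀ x) → ∃ σ₀ : ℝ, 0 < σ₀ ∧ ∀ σ : ℝ, 0 < σ → σ < σ₀ → ∀ (T : ℝ) (ρ θ : ℝ → Literature.MathematicalPhysics.KineticTheory.T3 → ℝ) (u : ℝ → Literature.MathematicalPhysics.KineticTheory.T3 → Literature.MathematicalPhysics.KineticTheory.V3), Literature.MathematicalPhysics.KineticTheory.IsHardSphereEulerSolution σ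 T ρ u θ → (∀ t ∈ Set.Ico 0 T, ∀ x, ρ t x * σ ^ 3 < η₀) → ∀ Φ : (N : ℕ) → Literature.Analysis.FluidPDE.HardSphereFlow (Literature.Analysis.FluidPDE.Torus.geometry (Fin 3)) (Literature.MathematicalPhysics.KineticTheory.hsDiameter σ N) (N + 1), Literature.MathematicalPhysics.KineticTheory.TendstoHydroFieldsAt (fun N => Literature.MathematicalPhysics.KineticTheory.localGibbsLaw σ a₀ u₀ θ₀ N (Φ N)) Φ ρ u θ 0 → ∀ t ∈ Set.Ico 0 T, Literature.MathematicalPhysics.KineticTheory.TendstoHydroFieldsAt (fun N => Literature.MathematicalPhysics.KineticTheory.localGibbsLaw σ a₀ u₀ θ₀ N (Φ N)) Φ ρ u θ t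

/-- item stmt-AtomisticToContinuum-3094 · support · rank 9 · closed · moot by None · by planner
sources: CaolaboraEtAl2025, BuckmasterCaolaboraGomezserrano2025, ShaoEtAl2025, MerleEtAl2022
[support] [support, literature input at σ = 0] there are continuous positive profiles (a₀, u₀, θ₀)
on 𝕋³ and a classical solution of the σ = 0 system (hsPressure 0 ρ θ = ρθ, E = ρ(|u|²/2 + 3θ/2): the
monatomic ideal gas, γ = 5/3) on some [0,T₁), T₁ > 0, with data (a₀/∫a₀, u₀, θ₀), whose density is
unbounded on [0,T₁). Source theorem: CaolaboraEtAl2025 Thm 1.2 (𝕋³_L, C^∞ data, ρ₀ > 0,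
finite-codimension set) + Rem 1.4 (any torus size by scaling) + Rem 1.5 (Euler, ν = 0) with γ = 5/3
profiles from BuckmasterCaolaboraGomezserrano2025 (p. 6: "for all γ > 1, including γ = 5/3") or
ShaoEtAl2025; isentropic smooth data θ₀ = K ρ₀^{2/3} reduce the full system to the barotropic one
while classical (entropy transport); mass normalisation ∫ρ₀ = 1 is free by the two-parameter scaling
of the ideal-gas system. [difficulty: XL] -/
@[route_item "route-AtomisticToContinuum-ImplosionLoophole"]
def IdealGasImplosion : Prop :=
  ∃ (a₀ θ₀ : Literature.MathematicalPhysics.KineticTheory.T3 → ℝ) (u₀ : Literature.MathematicalPhysics.KineticTheory.T3 → Literature.MathematicalPhysics.KineticTheory.V3), Continuous a₀ ∧ Continuous θ₀ ∧ Continuous u₀ ∧ (∀ x, 0 < a₀ x) ∧ (∀ x, 0 < θ₀ x) ∧ ∃ (T₁ : ℝ) (ρ₁ θ₁ : ℝ → Literature.MathematicalPhysics.KineticTheory.T3 → ℝ) (u₁ : ℝ → Literature.MathematicalPhysics.KineticTheory.T3 → Literature.MathematicalPhysics.KineticTheory.V3), 0 < T₁ ∧ Literature.MathematicalPhysics.KineticTheory.IsHardSphereEulerSolution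 0 T₁ ρ₁ u₁ θ₁ ∧ (∀ x, ρ₁ 0 x = a₀ x / ∫ y, a₀ y) ∧ u₁ 0 = u₀ ∧ θ₁ 0 = θ₀ ∧ ∀ M : ℝ, ∃ t ∈ Set.Ico 0 T₁, ∃ x, M ≤ ρ₁ t x

/-- item stmt-AtomisticToContinuum-3095 · support · rank 9 · closed · moot by None · by planner
sources: Kato1975, Majda1984, Ruelle1969, LebowitzPenrose1964, Spohn1991
[support] [support] continuous dependence on the equation-of-state parameter with existence: given
profiles and a classical σ = 0 solution (ρ₁,u₁,θ₁) on [0,T₁) with data (a₀/∫a₀, u₀, θ₀), for every 0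
< T₂ < T₁ and ε > 0 there is σ₀ such that for 0 < σ < σ₀ (i) an admissible classical
hard-sphere-Euler solution exists on some [0,T) with T > T₂ (local well-posedness of the
symmetric-hyperbolic hs-Euler system with Z analytic near 0, Kato1975/Majda1984, + the LLN for the
local Gibbs data), and (ii) every admissible classical solution is ε-close to ρ₁ in sup norm on [0,
min(T,T₂)] (uniqueness + Gronwall; data ρ_eq^σ → a₀/∫a₀ by LocalGibbsDensityLimit, hsPressure σ →
ideal uniformly on bounded densities by HsEosLowDensity 0768). [difficulty: L] -/
@[route_item "route-AtomisticToContinuum-ImplosionLoophole"]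
def EosContinuity : Prop :=
  ∀ (a₀ θ₀ : Literature.MathematicalPhysics.KineticTheory.T3 → ℝ) (u₀ : Literature.MathematicalPhysics.KineticTheory.T3 → Literature.MathematicalPhysics.KineticTheory.V3), Continuous a₀ → Continuous θ₀ → Continuous u₀ → (∀ x, 0 < a₀ x) → (∀ x, 0 < θ₀ x) → ∀ (T₁ : ℝ) (ρ₁ θ₁ : ℝ → Literature.MathematicalPhysics.KineticTheory.T3 → ℝ) (u₁ : ℝ → Literature.MathematicalPhysics.KineticTheory.T3 → Literature.MathematicalPhysics.KineticTheory.V3), Literature.MathematicalPhysics.KineticTheory.IsHardSphereEulerSolution 0 T₁ ρ₁ u₁ θ₁ → (∀ x, ρ₁ 0 x = a₀ x / ∫ y, a₀ y) → u₁ 0 = u₀ → θ₁ 0 = θ₀ → ∀ T₂ : ℝ, 0 < T₂ → T₂ < T₁ → ∀ ε : ℝ, 0 < ε → ∃ σ₀ : ℝ, 0 < σ₀ ∧ ∀ σ : ℝ, 0 < σ → σ < σ₀ → (∃ (T : ℝ) (ρ θ : ℝ → Literature.MathematicalPhysics.KineticTheory.T3 → ℝ) (u : ℝ → Literature.MathematicalPhysics.KineticTheory.T3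 → Literature.MathematicalPhysics.KineticTheory.V3), T₂ < T ∧ Literature.MathematicalPhysics.KineticTheory.IsHardSphereEulerSolution σ T ρ u θ ∧ ∀ Φ : (N : ℕ) → Literature.Analysis.FluidPDE.HardSphereFlow (Literature.Analysis.FluidPDE.Torus.geometry (Fin 3)) (Literature.MathematicalPhysics.KineticTheory.hsDiameter σ N) (N + 1), Literature.MathematicalPhysics.KineticTheory.TendstoHydroFieldsAt (fun N => Literature.MathematicalPhysics.KineticTheory.localGibbsLaw σ a₀ u₀ θ₀ N (Φ N)) Φ ρ u θ 0) ∧ ∀ (T : ℝ) (ρ θ : ℝ → Literature.MathematicalPhysics.KineticTheory.T3 → ℝ) (u : ℝ → Literature.MathematicalPhysics.KineticTheory.T3 → Literature.MathematicalPhysics.KineticTheory.V3), Literature.MathematicalPhysics.KineticTheory.IsHardSphereEulerSolution σ T ρ u θ → (∀ Φ : (N : ℕ) → Literature.Analysis.FluidPDE.HardSphereFlow (Literature.Analysis.FluidPDE.Torus.geometry (Fin 3)) (Literature.MathematicalPhysics.KineticTheory.hsDiameter σ N) (N + 1), Literature.MathematicalPhysics.KineticTheory.TendstoHydroFieldsAt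 (fun N => Literature.MathematicalPhysics.KineticTheory.localGibbsLaw σ a₀ u₀ θ₀ N (Φ N)) Φ ρ u θ 0) → ∀ t ∈ Set.Ico 0 T, t ≤ T₂ → ∀ x, |ρ t x - ρ₁ t x| < ε

/-- item stmt-AtomisticToContinuum-3096 · support · rank 9 · closed · moot by None · by planner
sources: CaolaboraEtAl2025, Kato1975, Majda1984
[support] [support, provable from IdealGasImplosion + EosContinuity] there are continuous positive
profiles such that for every M there is σ₀ with: for all 0 < σ < σ₀ an admissible classical
hard-sphere-Euler solution exists whose density exceeds M somewhere on its interval of existence.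
Records that no σ-uniform L^∞ density bound holds along the conjunct's solution class (the
qualitative implosion loophole); DenseExcursion / PolynomialCompression quantify it. [difficulty: L] -/
@[route_item "route-AtomisticToContinuum-ImplosionLoophole"]
def ImplosionUnboundedDensity : Prop :=
  ∃ (a₀ θ₀ : Literature.MathematicalPhysics.KineticTheory.T3 → ℝ) (u₀ : Literature.MathematicalPhysics.KineticTheory.T3 → Literature.MathematicalPhysics.KineticTheory.V3), Continuous a₀ ∧ Continuous θ₀ ∧ Continuous u₀ ∧ (∀ x, 0 < a₀ x) ∧ (∀ x, 0 < θ₀ x) ∧ ∀ M : ℝ, ∃ σ₀ : ℝ, 0 < σ₀ ∧ ∀ σ : ℝ, 0 < σ → σ < σ₀ → ∃ (T : ℝ) (ρ θ : ℝ → Literature.MathematicalPhysics.KineticTheory.T3 → ℝ) (u : ℝ → Literature.MathematicalPhysics.KineticTheory.T3 → Literature.MathematicalPhysics.KineticTheory.V3), Literature.MathematicalPhysics.KineticTheory.IsHardSphereEulerSolution σ T ρ u θ ∧ (∀ Φ : (N : ℕ) → Literature.Analysis.FluidPDE.HardSphereFlow (Literature.Analysis.FluidPDE.Torus.geometry (Fin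 3)) (Literature.MathematicalPhysics.KineticTheory.hsDiameter σ N) (N + 1), Literature.MathematicalPhysics.KineticTheory.TendstoHydroFieldsAt (fun N => Literature.MathematicalPhysics.KineticTheory.localGibbsLaw σ a₀ u₀ θ₀ N (Φ N)) Φ ρ u θ 0) ∧ ∃ t ∈ Set.Ico 0 T, ∃ x, M ≤ ρ t x

/-- item stmt-AtomisticToContinuum-3097 · support · rank 9 · closed · moot by None · by planner
sources: Ruelle1969, LebowitzPenrose1964, Spohn1991
[support] [support, statics] for continuous positive profiles and ε > 0 there is σ₀ such that for 0
< σ < σ₀ the canonical local Gibbs laws of N+1 hard spheres of diameter σ(N+1)^{-1/3} are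
probability measures for every N and every flow, and their empirical density / momentum / energy
fields at t = 0 satisfy the LLN (TendstoHydroFieldsAt at time 0) towards (ρ₀, ρ₀u₀, ρ₀(|u₀|²/2 +
3θ₀/2)) for a continuous ρ₀ with |ρ₀ − a₀/∫a₀| < ε uniformly (ideal-gas limit of the equilibrium
density at activity a₀; the O(σ³) rate for smooth a₀, needed by DenseExcursion /
PolynomialCompression, rides as a lemma). Strengthens the Literature fact localGibbs_lln and the
shared support LocalGibbsConcentration (stmt 0767) by identifying the limit density. [difficulty: M] -/
@[route_item "route-AtomisticToContinuum-ImplosionLoophole"]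
def LocalGibbsDensityLimit : Prop :=
  ∀ (a₀ θ₀ : Literature.MathematicalPhysics.KineticTheory.T3 → ℝ) (u₀ : Literature.MathematicalPhysics.KineticTheory.T3 → Literature.MathematicalPhysics.KineticTheory.V3), Continuous a₀ → Continuous θ₀ → Continuous u₀ → (∀ x, 0 < a₀ x) → (∀ x, 0 < θ₀ x) → ∀ ε : ℝ, 0 < ε → ∃ σ₀ : ℝ, 0 < σ₀ ∧ ∀ σ : ℝ, 0 < σ → σ < σ₀ → ∃ ρ₀ : Literature.MathematicalPhysics.KineticTheory.T3 → ℝ, Continuous ρ₀ ∧ (∀ x, |ρ₀ x - a₀ x / ∫ y, a₀ y| < ε) ∧ ∀ Φ : (N : ℕ) → Literature.Analysis.FluidPDE.HardSphereFlow (Literature.Analysis.FluidPDE.Torus.geometry (Fin 3)) (Literature.MathematicalPhysics.KineticTheory.hsDiameter σ N) (N + 1), (∀ N, MeasureTheory.IsProbabilityMeasure (Literature.MathematicalPhysics.KineticTheory.localGibbsLaw σ a₀ u₀ θ₀ N (Φ N))) ∧ Literature.MathematicalPhysics.KineticTheory.TendstoHydroFieldsAt (fun N => Literature.MathematicalPhysics.KineticTheory.localGibbsLaw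 σ a₀ u₀ θ₀ N (Φ N)) Φ (fun _ => ρ₀) (fun _ => u₀) (fun _ => θ₀) 0

/-- item stmt-AtomisticToContinuum-3098 · assembly · rank 1 · closed · moot by None · by planner
sources: Spohn1991
[assembly] DiluteSelfConsistency → HydroLimitInBand → HydrodynamicLimit (quantifier bookkeeping, min
of the two σ₀). -/
@[route_item "route-AtomisticToContinuum-ImplosionLoophole"]
def Assembly : Prop :=
  DiluteSelfConsistency → HydroLimitInBand → Literature.MathematicalPhysics.KineticTheory.HydrodynamicLimit

end Summit.AtomisticToContinuum.HydrodynamicLimit.Theses.ImplosionLoophole
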